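/-
Copyright (c) 2026 the pub-hodgecm-mathlib formalisation cell (harness21).  Prover seat hodgecm-mathlib-K2Liu-p13 (g3), Track B «K2-LIT»,
#184♮ = hLiu418 = `stmt-HodgeConjecture-24832`; ROAD Φ (RULING «M-156n»), consumer sheet fa2b1e3a29709f09 row G6-fin — letter (MOD) of
★ `K2LiuIntertwiningDeltaEquivariance.isSiegelDeltaSection_intertwiningDelta`, part B = the binder `hmod` VERBATIM (K2E5-plan (g7) co-deal (A) 2026-09-04T14:52:37Z);
census `K2/K2Liu-p13/g3/CENSUS-MOD-UnipDeltaConjugationModulusAdelic.K2Liu-p13-g3.md` 7506cbadfdc8c2cc.  THEOREMS ONLY (no `def`, no `instance`, no named-fact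
hypothesis, no `sorry`); pattern = ★ `K2LiuIntertwiningCentralRayEigen.map_conj_centralRay_eq_smul` (transport from the chart to every Haar measure on `unipDelta`).
-/
import Summits.HodgeConjecture.HodgeConjecture.Theorems.K2LiuUnipDeltaLeviModulusChart        -- ★ part A `exists_haar_conjBy_levi`
import Summits.HodgeConjecture.HodgeConjecture.Theorems.K2LiuIntertwiningCentralRayEigen      -- ★ the transport template (+ `conj_mem_unipDelta`, instances)
import Summits.HodgeConjecture.HodgeConjecture.Theorems.K2LiuIntertwiningDeltaLeviLaw         -- ★ `exists_levi_mul_unip` (adelic Levi decomposition)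
import Summits.HodgeConjecture.HodgeConjecture.Theorems.K2LiuModDeltaHeightComparison         -- ★ `modDelta_sq_eq_ideleNorm_det`
import Literature.NumberTheory.Automorphic.IdeleClassGroup                                   -- ★ `coe_ideleNorm`
import HarnessLib

/-!
# Crux `HLiu418`, ROAD Φ, organ Φ8 (sheet row G6-fin), letter (MOD) part B: THE MODULUS OF `Ad(P_Δ(𝔸))` ON `N_Δ(𝔸)` —
# `(u ↦ p⁻¹ u p)_* νN = modDelta(p)^{2n} • νN = |det_Δ p|_𝔸^{n} • νN` for EVERY Haar measure `νN` on `N_Δ(𝔸)` and EVERY `p ∈ P_Δ(𝔸)`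

Cell `hodgecm-mathlib`, crux item hLiu418 = `stmt-HodgeConjecture-24832` (helper lane, count-neutral).  GENERIC `n`, doubled frame `H(𝔸) = HA L e dV hdV dW hdW`,
`N_Δ(𝔸) = unipDelta` with a caller-supplied Borel structure.  ★ Part A `K2LiuUnipDeltaLeviModulusChart.exists_haar_conjBy_levi` computed the module of the Siegel
Levi on ONE Haar measure of the chart's `N_Δ`; this file transports it (★ `map_conj_centralRay_eq_smul` verbatim: the topological isomorphism `N_Δ(chart) ≅ unipDelta`,
Haar uniqueness `isMulLeftInvariant_eq_smul`) and extends it from the Levi to the whole parabolic by the adelic Levi decomposition `p = Λ g · n₀` (★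
`K2LiuIntertwiningDeltaLeviLaw.exists_levi_mul_unip`; `N_Δ(𝔸)` is commutative ★ `mul_comm_of_mem_unipDelta`, so `n₀` conjugates trivially), reading the module
`|det g|_𝔸^{n}` as `modDelta(p)^{2n}` (★ `K2LiuModDeltaHeightComparison.modDelta_sq_eq_ideleNorm_det`, ★ `coe_ideleNorm`):
**`map_conj_unipDelta_eq_smul`** — the binder `hmod` of ★ `K2LiuIntertwiningDeltaEquivariance.isSiegelDeltaSection_intertwiningDelta` ∕
`intertwiningDelta_family_equivariant`, VERBATIM.  With ★ (WCHAR) `K2LiuSiegelWeylCharacterLaw` this makes the global intertwining property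
`M(s) : I(s, χ) → I(−s, χ′)` unconditional (next file `K2LiuIntertwiningDeltaUnconditional`).
Sources: [Garrett2018, §3.10]; [MoeglinWaldspurger1995, II.1.5–II.1.6]; [HarrisKudlaSweet1996, §1 (1.11)–(1.15)]; [WeilBNT1967, Ch. IV §3].
HONEST LABEL.  Helper lemmas, count-neutral; `HC_CM` is proved only modulo the 7 printed citations (2 remaining named inputs:
hLiu418 = `stmt-HodgeConjecture-24832`, h413 = `stmt-HodgeConjecture-24833`) until rung 0 closes.
-/

set_option autoImplicit false
set_option linter.dupNamespace false -- the mandated namespace repeats `HodgeConjecture.HodgeConjecture`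

noncomputable section

open scoped Matrix NNReal ENNReal
open NumberField IsDedekindDomain MeasureTheory MeasureTheory.Measure

namespace Summit.HodgeConjecture.HodgeConjecture.Cruxes.HLiu418.K2LiuUnipDeltaConjugationModulusAdelic

open Literature.NumberTheory.GelbartRogawski1991.AdaptedBlocks
open Literature.NumberTheory.Automorphic Literature.NumberTheory.Automorphic.UnitaryGroup
open Literature.NumberTheory.GelbartRogawski1991 Literature.NumberTheory.GelbartRogawski1991.GRConstruction
open Literature.NumberTheory.K2Lit.SiegelDoubled Literature.NumberTheory.GaloisRepresentations
open UnitaryDualPair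
open Summit.HodgeConjecture.HodgeConjecture.Cruxes.HLiu418.K2LiuSiegelDoubledLeviAlgebra
open Summit.HodgeConjecture.HodgeConjecture.Cruxes.HLiu418.K2LiuSiegelDoubledBlkUnitary
open Summit.HodgeConjecture.HodgeConjecture.Cruxes.HLiu418.K2LiuSiegelDoubledLeviMatrix
open Summit.HodgeConjecture.HodgeConjecture.Cruxes.HLiu418.K2LiuSiegelDoubledLeviChart
open Summit.HodgeConjecture.HodgeConjecture.Cruxes.HLiu418.K2LiuSiegelDoubledUnipotentChart
open Summit.HodgeConjecture.HodgeConjecture.Cruxes.HLiu418.K2LiuSiegelDoubledUnipotentScaling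
open Summit.HodgeConjecture.HodgeConjecture.Cruxes.HLiu418.K2LiuSingularSectionVanishes
open Summit.HodgeConjecture.HodgeConjecture.Cruxes.HLiu418.K2LiuSiegelLeviConjUnipDeltaChar (conj_mem_unipDelta)
open Summit.HodgeConjecture.HodgeConjecture.Cruxes.HLiu418.K2LiuSiegelUnipotentHaarPinned (locallyCompactSpace_unipDelta secondCountableTopology_unipDelta)
open Summit.HodgeConjecture.HodgeConjecture.Cruxes.HLiu418.K2LiuUnipDeltaLeviModulusChart (exists_haar_conjBy_levi)
open Summit.HodgeConjecture.HodgeConjecture.Cruxes.HLiu418.K2LiuIntertwiningDeltaLeviLaw (exists_levi_mul_unip)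
open Summit.HodgeConjecture.HodgeConjecture.Cruxes.HLiu418.K2LiuModDeltaHeightComparison (modDelta_sq_eq_ideleNorm_det)

variable (L : Type) [Field L] [NumberField L] [IsCMField L]
variable {N M n : ℕ} (e : Fin N × Fin M ≃ Fin n)
  (dV : Fin N → L) (hdV : ∀ i, IsCMField.complexConj L (dV i) = dV i)
  (dW : Fin M → L) (hdW : ∀ i, IsCMField.complexConj L (dW i) = dW i)

/-! ## §1 Scalar bookkeeping: `|det g|_𝔸^{n} = modDelta(p)^{2n}` -/

/-- for `p ∈ P_Δ(𝔸)` with `Δ`-block `g`: `ENNReal.ofReal (modDelta p ^ (2n)) = ↑((adelicAbsDet n L g) ^ n)` (`modDelta(p)² = |det g|_𝔸`, ★ `modDelta_sq_eq_ideleNorm_det`).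
[cite: HarrisKudlaSweet1996, §1 (1.11)] [cite: WeilBNT1967, Ch. IV §3] -/
theorem ofReal_modDelta_pow_eq {p : HA L e dV hdV dW hdW} (hp : IsSiegelDelta L e dV hdV dW hdW p)
    {g : GL (Fin n) (AdeleRing (𝓞 L) L)} (hg : (g : Matrix (Fin n) (Fin n) (AdeleRing (𝓞 L) L)) = deltaBlock L e dV hdV dW hdW p) :
    ENNReal.ofReal (modDelta L e dV hdV dW hdW p ^ (2 * n)) = (((adelicAbsDet n L g) ^ n : ℝ≥0) : ℝ≥0∞) := by
  have h2 : modDelta L e dV hdV dW hdW p ^ 2 = ((adelicAbsDet n L g : ℝ≥0) : ℝ) := by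
    rw [modDelta_sq_eq_ideleNorm_det L e dV hdV dW hdW hp hg, ← coe_ideleNorm]
    rfl
  rw [pow_mul, h2, ← NNReal.coe_pow, ENNReal.ofReal_coe_nnreal]

/-! ## §2 The modulus of `Ad(P_Δ(𝔸))` on `N_Δ(𝔸)` -/

/-- **THE MODULUS OF `Ad(P_Δ(𝔸))` ON `N_Δ(𝔸)` — the binder `hmod` of ★ `isSiegelDeltaSection_intertwiningDelta`, VERBATIM.**  For every Haar measure `νN` on
`N_Δ(𝔸) = unipDelta` and every `p ∈ P_Δ(𝔸)`:  `(u ↦ p⁻¹ u p)_* νN = modDelta(p)^{2n} • νN` (`= |det_Δ p|_𝔸^{n} • νN`).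
PROOF: `p = Λ g · n₀` (★ `exists_levi_mul_unip` along the chart's Levi); `n₀ ∈ N_Δ(𝔸)` conjugates trivially (`N_Δ` commutative); for the Levi element, ★ part A
`exists_haar_conjBy_levi` on the chart's `N_Δ` transported along `N_Δ(chart) ≅ unipDelta` and Haar uniqueness (★ `map_conj_centralRay_eq_smul`'s pattern); §1 for the scalar.
[cite: Garrett2018, §3.10] [cite: MoeglinWaldspurger1995, II.1.6] [cite: HarrisKudlaSweet1996, §1 (1.11)–(1.15)] -/
theorem map_conj_unipDelta_eq_smul (hdV0 : ∀ i, dV i ≠ 0) (hdW0 : ∀ i, dW i ≠ 0)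
    [MeasurableSpace (unipDelta L e dV hdV dW hdW)] [BorelSpace (unipDelta L e dV hdV dW hdW)]
    (νN : Measure (unipDelta L e dV hdV dW hdW)) [νN.IsHaarMeasure]
    (p : HA L e dV hdV dW hdW) (hp : IsSiegelDelta L e dV hdV dW hdW p) :
    Measure.map (fun u : unipDelta L e dV hdV dW hdW =>
        (⟨p⁻¹ * (u : HA L e dV hdV dW hdW) * p, conj_mem_unipDelta L e dV hdV dW hdW hp u.2⟩ : unipDelta L e dV hdV dW hdW)) νN =
      ENNReal.ofReal (modDelta L e dV hdV dW hdW p ^ (2 * n)) • νN := by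
  classical
  haveI : LocallyCompactSpace (unipDelta L e dV hdV dW hdW) := locallyCompactSpace_unipDelta L e dV hdV dW hdW
  haveI : SecondCountableTopology (unipDelta L e dV hdV dW hdW) := secondCountableTopology_unipDelta L e dV hdV dW hdW
  letI : MeasurableSpace (HA L e dV hdV dW hdW) := borel _
  haveI : BorelSpace (HA L e dV hdV dW hdW) := ⟨rfl⟩
  -- the chart and the Levi module on it
  obtain ⟨Mg, Ng, eMN, φ, hS, hNg, hNgD, hφ⟩ := exists_siegelLeviChart L e dV hdV dW hdW hdV0 hdW0
  obtain ⟨μN, hμN, hlevi⟩ := exists_haar_conjBy_levi L e dV hdV dW hdW hdV0 hdW0 hS φ hNg hNgD hφ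
  -- the chart's Levi as a homomorphism into `H(𝔸)`, and the Levi decomposition of `p`
  set Λ : GL (Fin n) (AdeleRing (𝓞 L) L) →* HA L e dV hdV dW hdW :=
    ((siegelDelta L e dV hdV dW hdW).subtype.comp Mg.subtype).comp φ.toMonoidHom with hΛdef
  have hΛ : ∀ g : GL (Fin n) (AdeleRing (𝓞 L) L), blk L e dV hdV dW hdW (Λ g) =
      cayR (AdeleRing (𝓞 L) L) (Fin n) * Matrix.fromBlocks (g : Matrix (Fin n) (Fin n) (AdeleRing (𝓞 L) L)) 0 0
        (((gramR L e dV hdV dW hdW).map ((algebraMap L (AdeleRing (𝓞 L) L)).comp (algebraMap (Fp L) L)))⁻¹ *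
          (((g⁻¹ : GL (Fin n) (AdeleRing (𝓞 L) L)) : Matrix (Fin n) (Fin n) (AdeleRing (𝓞 L) L)).map
            (conjAdele (Fp L) L (IsCMField.complexConj L)))ᵀ *
          (gramR L e dV hdV dW hdW).map ((algebraMap L (AdeleRing (𝓞 L) L)).comp (algebraMap (Fp L) L))) *
        cayRinv (AdeleRing (𝓞 L) L) (Fin n) := fun g => hφ g
  obtain ⟨g, n₀, hg, hn₀, hpm⟩ := exists_levi_mul_unip L e dV hdV dW hdW Λ hΛ hdV0 hdW0 hp
  set a : ↥Mg := φ g with ha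
  have hΛa : Λ g = ((a : (siegelDelta L e dV hdV dW hdW : Subgroup (HA L e dV hdV dW hdW))) : HA L e dV hdV dW hdW) := rfl
  have hmP : IsSiegelDelta L e dV hdV dW hdW (Λ g) := isSiegelDelta_of_blk_eq_levi L e dV hdV dW hdW (hΛ g)
  -- `p⁻¹ u p = (Λ g)⁻¹ u (Λ g)`: `n₀` conjugates trivially on the commutative `N_Δ(𝔸)`
  have hconj_eq : (fun u : unipDelta L e dV hdV dW hdW =>
      (⟨p⁻¹ * (u : HA L e dV hdV dW hdW) * p, conj_mem_unipDelta L e dV hdV dW hdW hp u.2⟩ : unipDelta L e dV hdV dW hdW)) =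
      fun u : unipDelta L e dV hdV dW hdW =>
        (⟨(Λ g)⁻¹ * (u : HA L e dV hdV dW hdW) * Λ g, conj_mem_unipDelta L e dV hdV dW hdW hmP u.2⟩ : unipDelta L e dV hdV dW hdW) := by
    funext u
    apply Subtype.ext
    have hv : (Λ g)⁻¹ * (u : HA L e dV hdV dW hdW) * Λ g ∈ unipDelta L e dV hdV dW hdW := conj_mem_unipDelta L e dV hdV dW hdW hmP u.2
    have hcomm := mul_comm_of_mem_unipDelta L e dV hdV dW hdW hn₀ hv
    show p⁻¹ * (u : HA L e dV hdV dW hdW) * p = (Λ g)⁻¹ * (u : HA L e dV hdV dW hdW) * Λ g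
    rw [hpm, mul_inv_rev]
    calc n₀⁻¹ * (Λ g)⁻¹ * (u : HA L e dV hdV dW hdW) * (Λ g * n₀) = n₀⁻¹ * ((Λ g)⁻¹ * (u : HA L e dV hdV dW hdW) * Λ g) * n₀ := by
          simp only [mul_assoc]
      _ = n₀⁻¹ * (n₀ * ((Λ g)⁻¹ * (u : HA L e dV hdV dW hdW) * Λ g)) := by rw [hcomm, mul_assoc]
      _ = (Λ g)⁻¹ * (u : HA L e dV hdV dW hdW) * Λ g := by rw [inv_mul_cancel_left]
  rw [hconj_eq, ofReal_modDelta_pow_eq L e dV hdV dW hdW hp hg]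
  -- `N_Δ(chart) ≅ unipDelta`
  have hmemN : ∀ x : ↥Ng, (((x : ↥Ng) : (siegelDelta L e dV hdV dW hdW : Subgroup (HA L e dV hdV dW hdW))) : HA L e dV hdV dW hdW) ∈
      unipDelta L e dV hdV dW hdW := fun x =>
    mem_unipDelta_of_blk_eq_unip L e dV hdV dW hdW
      (blk_eq_unip L e dV hdV dW hdW ((x : (siegelDelta L e dV hdV dW hdW : Subgroup (HA L e dV hdV dW hdW))).2) ((hNg _).1 x.2) (hNgD _ x.2))
  have hmemNg : ∀ u : unipDelta L e dV hdV dW hdW,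
      (⟨(u : HA L e dV hdV dW hdW), unipDelta_le_siegelDelta L e dV hdV dW hdW u.2⟩ :
        (siegelDelta L e dV hdV dW hdW : Subgroup (HA L e dV hdV dW hdW))) ∈ Ng := fun u => by
    rw [hNg]
    obtain ⟨hP, hΔ, -⟩ := (mem_unipDelta_iff_blocks L e dV hdV dW hdW (u : HA L e dV hdV dW hdW)).1 u.2
    rw [blkA_eq_of_blkC_eq_zero ((blkC_eq_zero_iff _).2 hP)]
    exact hΔ
  let j : ↥Ng ≃* unipDelta L e dV hdV dW hdW :=
    { toFun := fun x => ⟨_, hmemN x⟩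
      invFun := fun u => ⟨⟨(u : HA L e dV hdV dW hdW), unipDelta_le_siegelDelta L e dV hdV dW hdW u.2⟩, hmemNg u⟩
      left_inv := fun x => rfl
      right_inv := fun u => rfl
      map_mul' := fun x y => rfl }
  have hjc : Continuous j := (continuous_subtype_val.comp continuous_subtype_val).subtype_mk _
  have hjsc : Continuous j.symm := (continuous_subtype_val.subtype_mk _).subtype_mk _
  have hjm : Measurable j := hjc.measurable
  haveI := hμN
  haveI : IsHaarMeasure (Measure.map j μN) := MulEquiv.isHaarMeasure_map (μ := μN) j hjc hjsc
  -- the conjugations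
  have hconjc : Continuous (hS.conjBy a) :=
    Continuous.subtype_mk ((continuous_const.mul continuous_subtype_val).mul continuous_const) _
  have hcm : Measurable (fun u : unipDelta L e dV hdV dW hdW =>
      (⟨(Λ g)⁻¹ * (u : HA L e dV hdV dW hdW) * Λ g, conj_mem_unipDelta L e dV hdV dW hdW hmP u.2⟩ : unipDelta L e dV hdV dW hdW)) :=
    (Continuous.subtype_mk ((continuous_const.mul continuous_subtype_val).mul continuous_const) _).measurable
  have hcomm : (fun u : unipDelta L e dV hdV dW hdW =>
      (⟨(Λ g)⁻¹ * (u : HA L e dV hdV dW hdW) * Λ g, conj_mem_unipDelta L e dV hdV dW hdW hmP u.2⟩ : unipDelta L e dV hdV dW hdW)) ∘ j =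
      j ∘ hS.conjBy a := by
    funext x
    apply Subtype.ext
    show (Λ g)⁻¹ * _ * Λ g = _
    rw [hΛa]
    rfl
  -- the identity for the transported Haar measure `j_* μN`
  have h₀ : Measure.map (fun u : unipDelta L e dV hdV dW hdW =>
      (⟨(Λ g)⁻¹ * (u : HA L e dV hdV dW hdW) * Λ g, conj_mem_unipDelta L e dV hdV dW hdW hmP u.2⟩ : unipDelta L e dV hdV dW hdW))
        (Measure.map j μN) = (((adelicAbsDet n L g) ^ n : ℝ≥0) : ℝ≥0∞) • Measure.map j μN := by
    rw [Measure.map_map hcm hjm, hcomm, ← Measure.map_map hjm hconjc.measurable, ha, hlevi g, Measure.map_smul]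
  -- Haar uniqueness: `νN = c • j_* μN`
  have hν : νN = haarScalarFactor νN (Measure.map j μN) • Measure.map j μN := isMulLeftInvariant_eq_smul νN (Measure.map j μN)
  rw [hν, Measure.map_smul, h₀, smul_comm]

/-! ## §3 The family form for every `p` (the `hmod` binder) and the unconditional intertwining property -/

/-- **`hmod` VERBATIM**: `∀ p (hp : IsSiegelDelta p), (u ↦ p⁻¹ u p)_* νN = modDelta(p)^{2n} • νN` for every Haar measure `νN` on `N_Δ(𝔸)`.
[cite: Garrett2018, §3.10] [cite: MoeglinWaldspurger1995, II.1.6] -/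
theorem hmod_holds (hdV0 : ∀ i, dV i ≠ 0) (hdW0 : ∀ i, dW i ≠ 0)
    [MeasurableSpace (unipDelta L e dV hdV dW hdW)] [BorelSpace (unipDelta L e dV hdV dW hdW)]
    (νN : Measure (unipDelta L e dV hdV dW hdW)) [νN.IsHaarMeasure] :
    ∀ (p : HA L e dV hdV dW hdW) (hp : IsSiegelDelta L e dV hdV dW hdW p),
      Measure.map (fun u : unipDelta L e dV hdV dW hdW =>
        (⟨p⁻¹ * (u : HA L e dV hdV dW hdW) * p, conj_mem_unipDelta L e dV hdV dW hdW hp u.2⟩ : unipDelta L e dV hdV dW hdW)) νN =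
        ENNReal.ofReal (modDelta L e dV hdV dW hdW p ^ (2 * n)) • νN :=
  fun p hp => map_conj_unipDelta_eq_smul L e dV hdV dW hdW hdV0 hdW0 νN p hp

end Summit.HodgeConjecture.HodgeConjecture.Cruxes.HLiu418.K2LiuUnipDeltaConjugationModulusAdelic

end
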